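import Mathlib.Tactic
import HarnessLib

/-!
# Kozma–Nitzan's Question 8 — the sub-root (nested) uniform form: re-rooting identities and the one-step prefix lemma (gen 34)

Support file (`--supports stmt-CriticalPhenomena-4575`, closed crux; independent mathematics on Kozma–Nitzan's Question 8,
arXiv:2401.12397 §5.5 p. 36), prover `prim-ineq-gen-6` (gen 34).  No definitions, no named facts, no sorries; standard axioms.
Memos `run/shared/lean/prim/prim-ineq-gen-6/FINDING-G34.md`, `PROOF-RCOS1-G34.md`.

The k₁ ≥ 2 programme (FINDING-G33 §2) needs the NESTED uniform form `UNIF-G′(i)`: for a block `T₁` with transparent root,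
`λ ∈ (0,1)`, terms `t₀ = (1−λ)x₀`, `t_l = X_l` (FINDING-G31 §1) and the crossing `K` of the SUB-ROOT `b_i`
(`C_[i+1,K](1+λ_i) < 1`, `λ_i = λα_iS_[2,i+1]`):  `t₀,…,t_i > 0 ⟹ Σ_{l<K} t_l ≤ 0`.  Gen 34 reduces it to two ingredients:
(a) the R-free uniform form `UNIF-G⁰` for the block re-rooted at `b_i` (the deep terms), through the exact re-rooting identity
`X_l = κ_i·X̃_{l−i} − SL_l` (`SL_l ≥ 0`, kernel `kSR_reroot_identity` / `kSR_reroot_slack_nonneg`); (b) a ONE-STEP PREFIX LEMMA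
`PRE − CR_i ≤ ¾κ_iB̃_i/(1+λ_i)` whose budget `B̃_i = λ_iu_{i+1} − T̃_i` is converted into post-prefix R-kills by LEMMA B
(a union bound of LEMMA V″ type, memo).  The assembly is `kSR_assembly`.  For `i = 1` the prefix lemma is the finite inequality
`(RC-OS1)`; this file certifies its real-arithmetic skeleton: the exact forms of the depth-0 bracket (`kOS_N_form`,
`kOS_N_split`), of `t₁ − CR₁` (`kOS_t1_minus_credit`), of the observer/credit comparison (`kOS_V1_minus_K1`), the AM–GM step
`c·λ′ ≤ λ²/(4(1+λ))` (`kOS_c_lamp`), the quadratic core of the v-observer piece (`kOS_Z_core`), the four scalar budgets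
(`kOS_S5`, `kOS_S2`, `kOS_S6`, `kOS_S3`) and their sum `< 1` (`kOS_budget_sum`).  The generalized merge identity used by the
sub-root merge step is `kSR_merge_identity`.
[cite: KozmaNitzan2024, Question 8 (§5.5 p. 36)]
-/

namespace Summit.CriticalPhenomena.PercolationContinuityZ3.Theorems

namespace PocketCert

/-- **Re-rooting identity (per depth).**  Depth-`l` term of the block, `X = w[κv̂(λαSu − T − ¾(1−α)/α) − (1−κ)λ²m₁û]`,
and of the block re-rooted at `b_i`, `X̃ = w[κ̃v̂(λ̃α̃S̃u − T̃ − ¾(1−α̃)/α̃) − (1−κ̃)λ̃²m̃₁û]`, with `κ = κ_i·κ̃` and the exact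
matching of the emission rates `λαS = λ̃α̃S̃`:  `κ_i·X̃ − X = SL` with
`SL = wκv̂[(T−T̃) + ¾((1−α)/α − (1−α̃)/α̃)] + wû[λ²(1−κ)m₁ − κ_i(1−κ̃)λ̃²m̃₁]`.
[cite: KozmaNitzan2024, Question 8 (§5.5 p. 36)] -/
theorem kSR_reroot_identity (w κ κi κt vh uh lam lamt α αt S St u T Tt m1 mt1 X Xt : ℝ)
    (hκ : κ = κi * κt) (hE : lam * α * S = lamt * αt * St)
    (hX : X = w * (κ * vh * (lam * α * S * u - T - 3 / 4 * ((1 - α) / α)) - (1 - κ) * lam ^ 2 * m1 * uh))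
    (hXt : Xt = w * (κt * vh * (lamt * αt * St * u - Tt - 3 / 4 * ((1 - αt) / αt)) - (1 - κt) * lamt ^ 2 * mt1 * uh)) :
    κi * Xt - X = w * κ * vh * ((T - Tt) + 3 / 4 * ((1 - α) / α - (1 - αt) / αt))
        + w * uh * (lam ^ 2 * (1 - κ) * m1 - κi * (1 - κt) * lamt ^ 2 * mt1) := by
  rw [hX, hXt, hκ, ← hE]; ring

/-- **Re-rooting slack is nonnegative.**  With `T ≥ T̃` (a sub-block has fewer bad classes), `(1−α)/α ≥ (1−α̃)/α̃` (prefix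
A-defects only increase the R-rate) and `λ²(1−κ)m₁ ≥ κ_i(1−κ̃)λ̃²m̃₁` (LL-domination: `m₁ ≥ α_iκ_iS m_{i+1}`, `λ̃ = λα_iS`),
all weights nonnegative:  `SL ≥ 0`, hence `X ≤ κ_i·X̃` termwise.
[cite: KozmaNitzan2024, Question 8 (§5.5 p. 36)] -/
theorem kSR_reroot_slack_nonneg (w κ κi κt vh uh lam lamt α αt m1 mt1 T Tt : ℝ)
    (hw : 0 ≤ w) (hκ0 : 0 ≤ κ) (hvh : 0 ≤ vh) (huh : 0 ≤ uh)
    (hT : Tt ≤ T) (hR : (1 - αt) / αt ≤ (1 - α) / α) (hL : κi * (1 - κt) * lamt ^ 2 * mt1 ≤ lam ^ 2 * (1 - κ) * m1) :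
    0 ≤ w * κ * vh * ((T - Tt) + 3 / 4 * ((1 - α) / α - (1 - αt) / αt))
        + w * uh * (lam ^ 2 * (1 - κ) * m1 - κi * (1 - κt) * lamt ^ 2 * mt1) := by
  have h1 : 0 ≤ (T - Tt) + 3 / 4 * ((1 - α) / α - (1 - αt) / αt) := by linarith
  have h2 : 0 ≤ lam ^ 2 * (1 - κ) * m1 - κi * (1 - κt) * lamt ^ 2 * mt1 := by linarith
  positivity

/-- **Generalized merge identity (any adjacent pair).**  Contracting the edge `e_{a+1}` (weight `σ`) merges `b_a b_{a+1}`; for a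
depth `l ≥ a+1` the block's root quantities are affine in `σ` with the merged values at `σ = 1`, the local channel quantities
coincide and `S = σ·S^m`.  Then `σ·X^m − X = EXC` with
`EXC = w[κv̂((T − σT^m) + (1−σ)¾(1−α)/α) + (1−κ)λ²û(m₁ − σm₁^m)]` (memo: `T − σT^m ≥ 0`, `m₁ − σm₁^m ≥ 0`, so `EXC ≥ 0`).
[cite: KozmaNitzan2024, Question 8 (§5.5 p. 36)] -/
theorem kSR_merge_identity (w κ vh uh lam α S Sm σ u T Tm m1 m1m X Xm : ℝ)
    (hS : S = σ * Sm)
    (hX : X = w * (κ * vh * (lam * α * S * u - T - 3 / 4 * ((1 - α) / α)) - (1 - κ) * lam ^ 2 * m1 * uh))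
    (hXm : Xm = w * (κ * vh * (lam * α * Sm * u - Tm - 3 / 4 * ((1 - α) / α)) - (1 - κ) * lam ^ 2 * m1m * uh)) :
    σ * Xm - X = w * (κ * vh * ((T - σ * Tm) + (1 - σ) * (3 / 4 * ((1 - α) / α)))
        + (1 - κ) * lam ^ 2 * uh * (m1 - σ * m1m)) := by
  rw [hX, hXm, hS]; ring

/-- **Assembly of the sub-root reduction.**  Exact bookkeeping: the nested sum splits as
`Σ_{l<K} t_l = (PRE − CR − SLS − RR) + κ_i·G⁰`, where `G⁰` is the R-free uniform form of the re-rooted block at weight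
`1−λ_i` (so `G⁰ ≤ 0` is the hypothesis UNIF-G⁰), `SLS ≥ 0` the re-rooting slack, `RR ≥ ¾κ_iR̂` the post-prefix R-kills,
`B̃ ≤ (1+λ_i)R̂` (LEMMA B) and the prefix lemma `PRE − CR ≤ θ·¾κ_iB̃/(1+λ_i)` with `θ ≤ 1`.  Then `Σ_{l<K} t_l ≤ 0`.
[cite: KozmaNitzan2024, Question 8 (§5.5 p. 36)] -/
theorem kSR_assembly (tot PRE CR SLS RR κi G0 Bt Rh lami θ : ℝ)
    (htot : tot = (PRE - CR - SLS - RR) + κi * G0) (hκ : 0 ≤ κi) (hG : G0 ≤ 0) (hS : 0 ≤ SLS)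
    (hl : 0 ≤ lami) (hRR : 3 / 4 * κi * Rh ≤ RR) (hB : Bt ≤ (1 + lami) * Rh) (hθ : θ ≤ 1)
    (hBt : 0 ≤ Bt) (hPRE : PRE - CR ≤ θ * (3 / 4 * κi * Bt / (1 + lami))) :
    tot ≤ 0 := by
  have h1 : 0 < 1 + lami := by linarith
  have h2 : 3 / 4 * κi * Bt / (1 + lami) ≤ 3 / 4 * κi * Rh := by
    rw [div_le_iff₀ h1]
    have : 3 / 4 * κi * Bt ≤ 3 / 4 * κi * ((1 + lami) * Rh) := by
      apply mul_le_mul_of_nonneg_left hB; positivity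
    nlinarith
  have h3 : 0 ≤ 3 / 4 * κi * Bt / (1 + lami) := by positivity
  have h4 : θ * (3 / 4 * κi * Bt / (1 + lami)) ≤ 1 * (3 / 4 * κi * Bt / (1 + lami)) :=
    mul_le_mul_of_nonneg_right hθ h3
  have h5 : κi * G0 ≤ 0 := mul_nonpos_of_nonneg_of_nonpos hκ hG
  nlinarith [h2, h4, h5]

/-! ## The one-step prefix lemma `(RC-OS1)` (i = 1): exact forms -/

/-- **Depth-0 bracket, exact form.**  With `u₁ = C[(1−A)m̃ + su]`, `T = T̃ + ΔT`,
`ΔT = (1−A)(1−C)m̃ + s(1−C)u + s(1−A)v` (one-step defect identity) and `λ′ = (1+λ)C − 1`: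
`λu₁ − T = λ′(su + (1−A)m̃) − T̃ − s(1−A)v`.
[cite: KozmaNitzan2024, Question 8 (§5.5 p. 36)] -/
theorem kOS_N_form (lam A C s u v mt Tt u1 T lamp : ℝ)
    (hu1 : u1 = C * ((1 - A) * mt + s * u))
    (hT : T = Tt + (1 - A) * (1 - C) * mt + s * (1 - C) * u + s * (1 - A) * v)
    (hlamp : lamp = (1 + lam) * C - 1) :
    lam * u1 - T = lamp * (s * u + (1 - A) * mt) - Tt - s * (1 - A) * v := by
  rw [hu1, hT, hlamp]; ring

/-- **Depth-0 bracket against the sub-root fuel.**  With `B̃ = λAsu − T̃`, `μ = λA ≠ 0`, `a = 1−A`, `c = 1−C`,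
`λ′ = (1+λ)C − 1 = λ − c(1+λ)`:
`λ′(su + am̃) − T̃ − asv = (λ′/μ)·B̃ + T̃·(λa − c(1+λ))/μ + a(λ′m̃ − sv)`  — the root sees the sub-root's net fuel `B̃` at the
reduced rate `λ′/μ`, plus its own A-defect fuel, minus a term that is negative when the C-defect dominates.
[cite: KozmaNitzan2024, Question 8 (§5.5 p. 36)] -/
theorem kOS_N_split (lam a s u v mt Tt c mu lamp Bt : ℝ)
    (hmu : mu = lam * (1 - a)) (hmu0 : mu ≠ 0) (hlamp : lamp = lam - c * (1 + lam))
    (hBt : Bt = mu * s * u - Tt) :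
    lamp * (s * u + a * mt) - Tt - a * s * v
      = (lamp / mu) * Bt + Tt * (lam * a - c * (1 + lam)) / mu + a * (lamp * mt - s * v) := by
  rw [hBt, hlamp]
  field_simp
  rw [hmu]
  ring

/-- **`t₁ − CR₁`, exact form.**  `t₁ = (1−s)[C(v/p)(λ₁u − T − ¾a/A) − cλ²ACm̃u/p]`, `CR₁ = C(1−λ₁)(v/p)B̃`, `λ₁ = μs`,
`B̃ = λ₁u − T̃`, `T = T̃ + ΔT`:  `t₁ − CR₁ = −C(v/p)[s(1−μ)B̃ + (1−s)(ΔT + ¾a/A)] − (1−s)cλ²ACm̃u/p` (all kills).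
[cite: KozmaNitzan2024, Question 8 (§5.5 p. 36)] -/
theorem kOS_t1_minus_credit (s C v p u T Tt dT a A c lam mu lam1 Bt mt t1 CR : ℝ)
    (hl1 : lam1 = mu * s) (hBt : Bt = lam1 * u - Tt) (hT : T = Tt + dT)
    (ht1 : t1 = (1 - s) * (C * (v / p) * (lam1 * u - T - 3 / 4 * a / A) - c * lam ^ 2 * A * C * mt * u / p))
    (hCR : CR = C * (1 - lam1) * (v / p) * Bt) :
    t1 - CR = -(C * (v / p) * (s * (1 - mu) * Bt + (1 - s) * (dT + 3 / 4 * a / A)))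
        - (1 - s) * c * lam ^ 2 * A * C * mt * u / p := by
  rw [ht1, hCR, hBt, hT, hl1]; ring

/-- **The v-observer against the credit surplus, exact form.**  With `p₀ = p − ΔT` (`p, p₀ ≠ 0`), `μ = λA`, `λ′ = λ − c(1+λ)`,
`C = 1 − c`, `A = 1 − a`, `V1 := (1−λ)(Asv/p₀)(λ′/μ)B̃` and `K1 := C(1−μ)s(v/p)B̃`:
`V1 − K1 = C(1−μ)s(v/p)B̃·ΔT/p₀ − λaCsvB̃/p₀ − (1−λ)(c/λ)svB̃/p₀` — the observer's excess over the credit surplus is exactly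
the normalisation mismatch minus two spare terms (one ∝ a, one ∝ c).
[cite: KozmaNitzan2024, Question 8 (§5.5 p. 36)] -/
theorem kOS_V1_minus_K1 (lam A C a c s v p p0 dT mu lamp Bt : ℝ)
    (hA : A = 1 - a) (hC : C = 1 - c) (hmu : mu = lam * A) (hlamp : lamp = lam - c * (1 + lam))
    (hp0 : p0 = p - dT) (hp : p ≠ 0) (hp0' : p0 ≠ 0) (hlam : lam ≠ 0) (hA0 : A ≠ 0) :
    (1 - lam) * (A * s * v / p0) * (lamp / mu) * Bt - C * (1 - mu) * s * (v / p) * Bt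
      = C * (1 - mu) * s * (v / p) * Bt * dT / p0 - lam * a * C * s * v * Bt / p0
        - (1 - lam) * (c / lam) * s * v * Bt / p0 := by
  have hmu0 : mu ≠ 0 := by rw [hmu]; exact mul_ne_zero hlam hA0
  have hdT : dT = p - p0 := by linarith
  rw [hdT, hC, hlamp, hmu]
  rw [hmu] at hmu0
  field_simp
  rw [hA]
  ring

/-! ## The one-step prefix lemma `(RC-OS1)`: scalar cores -/

/-- **AM–GM for the C-lens.**  `c·(λ − (1+λ)c) ≤ λ²/(4(1+λ))` for `λ > −1` (used with `λ′ = λ − c(1+λ)`: `cλ′ ≤ λ²/(4(1+λ))`).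
[cite: KozmaNitzan2024, Question 8 (§5.5 p. 36)] -/
theorem kOS_c_lamp (lam c : ℝ) (hl : 0 ≤ lam) :
    c * (lam - (1 + lam) * c) ≤ lam ^ 2 / (4 * (1 + lam)) := by
  have h1 : 0 < 4 * (1 + lam) := by linarith
  rw [le_div_iff₀ h1]
  nlinarith [sq_nonneg (2 * (1 + lam) * c - lam)]

/-- **Quadratic core of the v-observer piece.**  For `0 ≤ λ ≤ 8`:  `z(λ − (1+λ)z) ≤ (λ²/4)(1 − z)`, i.e.
`(1+λ)z² − (λ + λ²/4)z + λ²/4 ≥ 0` (discriminant `λ³(λ−8)/16 ≤ 0`).  Used as `Z/(1−z) ≤ λ²/4` for `z = sy < 1`.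
[cite: KozmaNitzan2024, Question 8 (§5.5 p. 36)] -/
theorem kOS_Z_core (lam z : ℝ) (hl0 : 0 ≤ lam) (hl8 : lam ≤ 8) :
    z * (lam - (1 + lam) * z) ≤ lam ^ 2 / 4 * (1 - z) := by
  -- 16(1+λ)·[(λ²/4)(1−z) − z(λ−(1+λ)z)] = (4(1+λ)z − (2λ + λ²/2))² + λ³(8−λ)/... ; direct SOS:
  nlinarith [sq_nonneg (4 * (1 + lam) * z - 2 * lam - lam ^ 2 / 2), mul_nonneg (mul_nonneg hl0 (mul_nonneg hl0 hl0)) (by linarith : (0:ℝ) ≤ 8 - lam),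
    mul_nonneg hl0 hl0]

/-- **Budget S5** (the C-lens × sub-root fuel piece): `λ(1−λ²) ≤ 0.385` on `[0,1]` (max `2/(3√3) = 0.38490…` at `λ = 1/√3`).
[cite: KozmaNitzan2024, Question 8 (§5.5 p. 36)] -/
theorem kOS_S5 (lam : ℝ) (hl0 : 0 ≤ lam) (hl1 : lam ≤ 1) : lam * (1 - lam ^ 2) ≤ 385 / 1000 := by
  nlinarith [mul_nonneg (sq_nonneg (lam - 4330 / 7500)) (by linarith : (0:ℝ) ≤ lam + 8660 / 7500), sq_nonneg lam]

/-- **Budget S2** (the v-observer × A-fuel piece): `λ²(1−λ)(1+λ)³ ≤ 4/5` on `[0,1]` (max `0.7562…`).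
[cite: KozmaNitzan2024, Question 8 (§5.5 p. 36)] -/
theorem kOS_S2 (lam : ℝ) (hl0 : 0 ≤ lam) (hl1 : lam ≤ 1) : lam ^ 2 * (1 - lam) * (1 + lam) ^ 3 ≤ 4 / 5 := by
  have h1 : 0 ≤ 1 - lam := by linarith
  nlinarith [mul_nonneg (mul_nonneg (sq_nonneg (lam - 77 / 100)) h1) (sq_nonneg lam),
    mul_nonneg (mul_nonneg (sq_nonneg (lam - 77 / 100)) hl0) (sq_nonneg (1 + lam)),
    mul_nonneg (sq_nonneg (lam - 77/100)) h1, mul_nonneg h1 hl0, sq_nonneg (lam ^ 2 - 6/10),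
    mul_nonneg (mul_nonneg h1 hl0) (sq_nonneg (lam - 77/100)), mul_nonneg (pow_nonneg hl0 3) h1,
    mul_nonneg (pow_nonneg hl0 4) h1, mul_nonneg (pow_nonneg hl0 5) h1]

/-- **Budget S6** (the C-lens × A-fuel piece): `(1−λ)λ²(1+λ)(1−t)(1+3t) ≤ (11/20)(1 − λt)` on `[0,1]²` (max ratio `0.5025…`).
Proof by the tangent line of the concave `t ↦ (1−t)(1+3t)` at `t₀ = 0.62` (for `λ ≤ 0.82`) resp. `t₀ = 0.7` (for `λ ≥ 0.82`),
which makes the claim linear in `t`, and the endpoint inequalities (`λ² − λ⁴ ≤ ¼`, monotonicity).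
[cite: KozmaNitzan2024, Question 8 (§5.5 p. 36)] -/
theorem kOS_S6 (lam t : ℝ) (hl0 : 0 ≤ lam) (hl1 : lam ≤ 1) (ht0 : 0 ≤ t) (ht1 : t ≤ 1) :
    (1 - lam) * lam ^ 2 * (1 + lam) * ((1 - t) * (1 + 3 * t)) ≤ 11 / 20 * (1 - lam * t) := by
  have h1 : 0 ≤ 1 - lam := by linarith
  have h2 : 0 ≤ 1 - t := by linarith
  have hP : 0 ≤ (1 - lam) * lam ^ 2 * (1 + lam) := by positivity
  rcases le_or_gt lam (82 / 100) with hA | hB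
  · -- tangent at t₀ = 31/50
    have hf : (1 - t) * (1 + 3 * t) ≤ 5383 / 2500 - 43 / 25 * t := by nlinarith [sq_nonneg (t - 31 / 50)]
    have h3 := mul_le_mul_of_nonneg_left hf hP
    have E0 : (1 - lam) * lam ^ 2 * (1 + lam) ≤ 2554 / 10000 := by
      nlinarith [sq_nonneg (lam ^ 2 - 1 / 2)]
    have E1 : lam ^ 2 * (1 + lam) ≤ 12696 / 10000 := by nlinarith [mul_nonneg hl0 hl0, mul_nonneg (mul_nonneg hl0 hl0) hl0]
    nlinarith [mul_nonneg h2 (by linarith : (0:ℝ) ≤ 2554 / 10000 - (1 - lam) * lam ^ 2 * (1 + lam)),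
      mul_nonneg ht0 (by nlinarith : (0:ℝ) ≤ 11 / 20 * (1 - lam) - 1083 / 2500 * ((1 - lam) * lam ^ 2 * (1 + lam)))]
  · -- tangent at t₀ = 7/10
    have hf : (1 - t) * (1 + 3 * t) ≤ 247 / 100 - 11 / 5 * t := by nlinarith [sq_nonneg (t - 7 / 10)]
    have h3 := mul_le_mul_of_nonneg_left hf hP
    have hB0 : 0 ≤ lam - 82 / 100 := by linarith [hB.le]
    have E0 : (1 - lam) * lam ^ 2 * (1 + lam) ≤ 2227 / 10000 := by
      nlinarith [mul_nonneg hB0 h1, mul_nonneg (mul_nonneg hB0 h1) hl0, mul_nonneg (mul_nonneg hB0 h1) (mul_nonneg hl0 hl0),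
        mul_nonneg (mul_nonneg hB0 hB0) h1, mul_nonneg hB0 (mul_nonneg hl0 hl0)]
    have E1 : lam ^ 2 * (1 + lam) ≤ 2 := by nlinarith [mul_nonneg hl0 hl0, mul_nonneg (mul_nonneg hl0 hl0) hl0]
    nlinarith [mul_nonneg h2 (by linarith : (0:ℝ) ≤ 2227 / 10000 * (247/100) - 247/100 * ((1 - lam) * lam ^ 2 * (1 + lam))),
      mul_nonneg ht0 (by nlinarith : (0:ℝ) ≤ 11 / 20 * (1 - lam) - 27 / 100 * ((1 - lam) * lam ^ 2 * (1 + lam)))]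

/-- **Budget S3** (the C-part of the normalisation mismatch): with `μ = 1 − q²` (`q = √(1−μ) ∈ [0,1]`),
`(1−μ)μ(3+4μ)·x(1−x) ≤ (13/25)(1 − μx)` on `[0,1]²` (max ratio `0.5085…`).  Proof: the perfect square `((1+q)x − 1)² ≥ 0` gives
`x(1−x)(1+q)² ≤ 1 − μx` (the exact maximum `x(1−x)/(1−μx) ≤ 1/(1+q)²`), reducing the claim to the one-variable inequality
`q²(1−q)(7−4q²) ≤ (13/25)(1+q)`.
[cite: KozmaNitzan2024, Question 8 (§5.5 p. 36)] -/
theorem kOS_S3 (q x : ℝ) (hq0 : 0 ≤ q) (hq1 : q ≤ 1) (hx0 : 0 ≤ x) (hx1 : x ≤ 1) :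
    (q ^ 2) * (1 - q ^ 2) * (7 - 4 * q ^ 2) * (x * (1 - x)) ≤ 13 / 25 * (1 - (1 - q ^ 2) * x) := by
  have hx : x * (1 - x) * (1 + q) ^ 2 ≤ 1 - (1 - q ^ 2) * x := by nlinarith [sq_nonneg ((1 + q) * x - 1)]
  have h1q : 0 ≤ 1 - q := by linarith
  have hq : q ^ 2 * (1 - q) * (7 - 4 * q ^ 2) ≤ 13 / 25 * (1 + q) := by
    nlinarith [mul_nonneg (sq_nonneg (q - 14/25)) hq0, mul_nonneg (sq_nonneg (q - 14/25)) h1q,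
      mul_nonneg (mul_nonneg (sq_nonneg (q-14/25)) hq0) hq0, mul_nonneg (mul_nonneg (sq_nonneg (q-14/25)) hq0) h1q,
      mul_nonneg hq0 h1q, sq_nonneg q, mul_nonneg (pow_nonneg hq0 3) h1q]
  have hW : 0 ≤ 1 - (1 - q ^ 2) * x := by nlinarith
  have hP : 0 ≤ q ^ 2 * (1 - q) * (7 - 4 * q ^ 2) := by
    have : 0 ≤ 7 - 4 * q ^ 2 := by nlinarith
    positivity
  have hpos : 0 < 1 + q := by linarith
  have key : (1 + q) * ((q ^ 2) * (1 - q ^ 2) * (7 - 4 * q ^ 2) * (x * (1 - x)))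
      ≤ (1 + q) * (13 / 25 * (1 - (1 - q ^ 2) * x)) := by
    have e1 : (1 + q) * ((q ^ 2) * (1 - q ^ 2) * (7 - 4 * q ^ 2) * (x * (1 - x)))
        = (q ^ 2 * (1 - q) * (7 - 4 * q ^ 2)) * (x * (1 - x) * (1 + q) ^ 2) := by ring
    rw [e1]
    have e2 : (q ^ 2 * (1 - q) * (7 - 4 * q ^ 2)) * (x * (1 - x) * (1 + q) ^ 2)
        ≤ (q ^ 2 * (1 - q) * (7 - 4 * q ^ 2)) * (1 - (1 - q ^ 2) * x) := mul_le_mul_of_nonneg_left hx hP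
    have e3 : (q ^ 2 * (1 - q) * (7 - 4 * q ^ 2)) * (1 - (1 - q ^ 2) * x)
        ≤ (13 / 25 * (1 + q)) * (1 - (1 - q ^ 2) * x) := mul_le_mul_of_nonneg_right hq hW
    nlinarith [e2, e3]
  exact le_of_mul_le_mul_left key hpos

/-- **Sum of the four budgets** of `(RC-OS1)`: `0.385/3 + (4/9)(4/5) + (4/9)(11/20) + (4/9)(1/2)(13/25) < 1` (`= 0.8439`),
so `DEF ≤ 0.844·¾CB̃/(1+λ₁) < ¾CB̃/(1+λ₁)`.
[cite: KozmaNitzan2024, Question 8 (§5.5 p. 36)] -/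
theorem kOS_budget_sum :
    (385 / 1000 : ℝ) / 3 + 4 / 9 * (4 / 5) + 4 / 9 * (11 / 20) + 4 / 9 * (1 / 2) * (13 / 25) < 1 := by
  norm_num

end PocketCert

end Summit.CriticalPhenomena.PercolationContinuityZ3.Theorems
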